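import Summits.ValiantsHypothesis.ValiantsHypothesis.Theorems.LiftNullstellensatzLiftWidthPerFourRungOneLinSyzygy

/-!
# Route LiftNullstellensatz — `LiftWidthPerFour` (stmt-ValiantsHypothesis-5922), CASE A rung 1:
quadratic syzygies of the three `2 × 2` permanents are Koszul

Companion of `…RungOneLinSyzygy` (normalised indices: middle rows `1, 2`, live columns `1, 2, 3`;
`p23 = y₂z₃ + y₃z₂`, `p13 = y₁z₃ + y₃z₁`, `p12 = y₁z₂ + y₂z₁`):

* `quadSyzygy_koszul` — a syzygy `n₁ p23 + n₂ p13 + n₃ p12 = 0` with homogeneous QUADRATIC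
  coefficients is a scalar combination of the three Koszul syzygies (proof by "peeling":
  `nₖ ∈ (yₖ, zₖ)`, four double substitutions, evaluation at four `0/1` points; needs `2 ≠ 0`);
* `minors_eq_zero_of_cross_dot_eq_zero` — if the cross product of two triples of linear forms is
  orthogonal to `(p23, p13, p12)` then it vanishes: the rank-`2` step of the rung-1 argument for
  CASE A (`Cruxes/LiftWidthPerFour/CASEA-RUNG1-p2.md` §3).

No new definitions.  VP ≠ VNP is not moved by this item.
-/

noncomputable section

open MvPolynomial

namespace Summit.ValiantsHypothesis.LiftNullstellensatz

variable {K : Type*} [Field K]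

/-- **Quadratic syzygies are Koszul**: if `n₁ p23 + n₂ p13 + n₃ p12 = 0` with homogeneous quadrics
`nᵢ` (`2 ≠ 0` in `K`), then `(n₁, n₂, n₃) = λ·(p13, −p23, 0) + μ·(p12, 0, −p23) + ν·(0, p12, −p13)`
for scalars `λ, μ, ν`.  Proof by peeling: `nₖ ∈ (y_k, z_k)`, four double substitutions, and an
evaluation at four `0/1` points. [folklore] -/
theorem quadSyzygy_koszul (h2 : (2 : K) ≠ 0) (n₁ n₂ n₃ : MvPolynomial (Fin 4 × Fin 4) K)
    (hn₁ : n₁.IsHomogeneous 2) (hn₂ : n₂.IsHomogeneous 2) (hn₃ : n₃.IsHomogeneous 2)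
    (h : n₁ * (X (1, 2) * X (2, 3) + X (1, 3) * X (2, 2)) +
         n₂ * (X (1, 1) * X (2, 3) + X (1, 3) * X (2, 1)) +
         n₃ * (X (1, 1) * X (2, 2) + X (1, 2) * X (2, 1)) = 0) :
    ∃ lam mu nu : K,
      n₁ = C lam * (X (1, 1) * X (2, 3) + X (1, 3) * X (2, 1)) +
           C mu * (X (1, 1) * X (2, 2) + X (1, 2) * X (2, 1)) ∧
      n₂ = -(C lam * (X (1, 2) * X (2, 3) + X (1, 3) * X (2, 2))) +
           C nu * (X (1, 1) * X (2, 2) + X (1, 2) * X (2, 1)) ∧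
      n₃ = -(C mu * (X (1, 2) * X (2, 3) + X (1, 3) * X (2, 2))) -
           C nu * (X (1, 1) * X (2, 3) + X (1, 3) * X (2, 1)) := by
  classical
  -- names for the six variables
  set y1 : MvPolynomial (Fin 4 × Fin 4) K := X (1, 1) with hy1
  set y2 : MvPolynomial (Fin 4 × Fin 4) K := X (1, 2) with hy2
  set y3 : MvPolynomial (Fin 4 × Fin 4) K := X (1, 3) with hy3
  set z1 : MvPolynomial (Fin 4 × Fin 4) K := X (2, 1) with hz1
  set z2 : MvPolynomial (Fin 4 × Fin 4) K := X (2, 2) with hz2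
  set z3 : MvPolynomial (Fin 4 × Fin 4) K := X (2, 3) with hz3
  -- Step 1: nₖ = yₖ uₖ + zₖ vₖ with uₖ, vₖ linear
  have step1 : ∀ (k b d : Fin 4) (L M N : MvPolynomial (Fin 4 × Fin 4) K), L.IsHomogeneous 2 →
      k ≠ b → k ≠ d → b ≠ d →
      L * (X (1, b) * X (2, d) + X (1, d) * X (2, b)) +
        M * (X (1, k) * X (2, d) + X (1, d) * X (2, k)) +
        N * (X (1, k) * X (2, b) + X (1, b) * X (2, k)) = 0 →
      ∃ u v : MvPolynomial (Fin 4 × Fin 4) K, u.IsHomogeneous 1 ∧ v.IsHomogeneous 1 ∧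
        L = X (1, k) * u + X (2, k) * v := by
    intro k b d L M N hL hkb hkd hbd hLMN
    refine exists_linear_of_kill_pair_eq_zero (1, k) (2, k) hL
      (aeval_eq_zero_of_syzygy hbd _ ?_ ?_ ?_ ?_ ?_ ?_ L M N hLMN) <;>
      simp [hkb.symm, hkd.symm]
  obtain ⟨u₁, v₁, hu₁, hv₁, e₁⟩ := step1 1 2 3 n₁ n₂ n₃ hn₁ (by decide) (by decide) (by decide) h
  obtain ⟨u₂, v₂, hu₂, hv₂, e₂⟩ := step1 2 1 3 n₂ n₁ n₃ hn₂ (by decide) (by decide) (by decide)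
    (by rw [← h]; ring)
  obtain ⟨u₃, v₃, hu₃, hv₃, e₃⟩ := step1 3 1 2 n₃ n₁ n₂ hn₃ (by decide) (by decide) (by decide)
    (by rw [← h]; ring)
  -- the main identity (1)
  have h1 : (y1 * u₁ + z1 * v₁) * (y2 * z3 + y3 * z2) + (y2 * u₂ + z2 * v₂) * (y1 * z3 + y3 * z1) +
      (y3 * u₃ + z3 * v₃) * (y1 * z2 + y2 * z1) = 0 := by
    rw [← e₁, ← e₂, ← e₃]; exact h
  -- Step 2: four double substitutions
  have hC2 : (C (2 : K) : MvPolynomial (Fin 4 × Fin 4) K) = 2 := map_ofNat C 2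
  have X3ne : ∀ v₁ v₂ v₃ : Fin 4 × Fin 4,
      (X v₁ * X v₂ * X v₃ : MvPolynomial (Fin 4 × Fin 4) K) ≠ 0 := fun _ _ _ =>
    mul_ne_zero (mul_ne_zero (X_ne_zero _) (X_ne_zero _)) (X_ne_zero _)
  -- (a) kill y1, y2 : v₁ + v₂ = α y1 + β y2
  obtain ⟨α, β, hαβ⟩ : ∃ α β : K, v₁ + v₂ = C α * y1 + C β * y2 := by
    refine exists_pair_of_kill_eq_zero (by decide) (hv₁.add hv₂) ?_
    set κ : MvPolynomial (Fin 4 × Fin 4) K →ₐ[K] MvPolynomial (Fin 4 × Fin 4) K :=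
      aeval fun i => if i ∈ ({((1 : Fin 4), (1 : Fin 4)), (1, 2)} : Finset (Fin 4 × Fin 4)) then
        (0 : MvPolynomial (Fin 4 × Fin 4) K) else X i with hκ
    have hκX : ∀ v : Fin 4 × Fin 4, κ (X v) =
        if v ∈ ({((1 : Fin 4), (1 : Fin 4)), (1, 2)} : Finset (Fin 4 × Fin 4)) then 0 else X v :=
      fun v => by rw [hκ, aeval_X]
    have hk := congrArg κ h1
    simp only [map_add, map_mul, map_zero, hκX, hy1, hy2, hy3, hz1, hz2, hz3, Finset.mem_insert,
      Finset.mem_singleton, Prod.mk.injEq, Fin.reduceEq, and_true, and_false, or_false, or_true,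
      if_true, if_false, zero_mul, mul_zero, add_zero, zero_add] at hk
    have hprod : X (1, 3) * X (2, 1) * X (2, 2) * κ (v₁ + v₂) = 0 := by
      rw [map_add]; linear_combination hk
    exact (mul_eq_zero.1 hprod).resolve_left (X3ne _ _ _)
  -- (b) kill y1, y3 : v₁ + v₃ = α' y1 + γ' y3
  obtain ⟨α', γ', hαγ⟩ : ∃ α' γ' : K, v₁ + v₃ = C α' * y1 + C γ' * y3 := by
    refine exists_pair_of_kill_eq_zero (by decide) (hv₁.add hv₃) ?_
    set κ : MvPolynomial (Fin 4 × Fin 4) K →ₐ[K] MvPolynomial (Fin 4 × Fin 4) K :=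
      aeval fun i => if i ∈ ({((1 : Fin 4), (1 : Fin 4)), (1, 3)} : Finset (Fin 4 × Fin 4)) then
        (0 : MvPolynomial (Fin 4 × Fin 4) K) else X i with hκ
    have hκX : ∀ v : Fin 4 × Fin 4, κ (X v) =
        if v ∈ ({((1 : Fin 4), (1 : Fin 4)), (1, 3)} : Finset (Fin 4 × Fin 4)) then 0 else X v :=
      fun v => by rw [hκ, aeval_X]
    have hk := congrArg κ h1
    simp only [map_add, map_mul, map_zero, hκX, hy1, hy2, hy3, hz1, hz2, hz3, Finset.mem_insert,
      Finset.mem_singleton, Prod.mk.injEq, Fin.reduceEq, and_true, and_false, or_false, or_true,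
      if_true, if_false, zero_mul, mul_zero, add_zero, zero_add] at hk
    have hprod : X (1, 2) * X (2, 1) * X (2, 3) * κ (v₁ + v₃) = 0 := by
      rw [map_add]; linear_combination hk
    exact (mul_eq_zero.1 hprod).resolve_left (X3ne _ _ _)
  -- (c) kill z1, z2 : u₁ + u₂ = a z1 + b z2
  obtain ⟨a, b, hab⟩ : ∃ a b : K, u₁ + u₂ = C a * z1 + C b * z2 := by
    refine exists_pair_of_kill_eq_zero (by decide) (hu₁.add hu₂) ?_
    set κ : MvPolynomial (Fin 4 × Fin 4) K →ₐ[K] MvPolynomial (Fin 4 × Fin 4) K :=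
      aeval fun i => if i ∈ ({((2 : Fin 4), (1 : Fin 4)), (2, 2)} : Finset (Fin 4 × Fin 4)) then
        (0 : MvPolynomial (Fin 4 × Fin 4) K) else X i with hκ
    have hκX : ∀ v : Fin 4 × Fin 4, κ (X v) =
        if v ∈ ({((2 : Fin 4), (1 : Fin 4)), (2, 2)} : Finset (Fin 4 × Fin 4)) then 0 else X v :=
      fun v => by rw [hκ, aeval_X]
    have hk := congrArg κ h1
    simp only [map_add, map_mul, map_zero, hκX, hy1, hy2, hy3, hz1, hz2, hz3, Finset.mem_insert,
      Finset.mem_singleton, Prod.mk.injEq, Fin.reduceEq, and_true, and_false, or_false, or_true,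
      if_true, if_false, zero_mul, mul_zero, add_zero] at hk
    have hprod : X (1, 1) * X (1, 2) * X (2, 3) * κ (u₁ + u₂) = 0 := by
      rw [map_add]; linear_combination hk
    exact (mul_eq_zero.1 hprod).resolve_left (X3ne _ _ _)
  -- (d) kill z1, z3 : u₁ + u₃ = a' z1 + c' z3
  obtain ⟨a', c', hac⟩ : ∃ a' c' : K, u₁ + u₃ = C a' * z1 + C c' * z3 := by
    refine exists_pair_of_kill_eq_zero (by decide) (hu₁.add hu₃) ?_
    set κ : MvPolynomial (Fin 4 × Fin 4) K →ₐ[K] MvPolynomial (Fin 4 × Fin 4) K :=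
      aeval fun i => if i ∈ ({((2 : Fin 4), (1 : Fin 4)), (2, 3)} : Finset (Fin 4 × Fin 4)) then
        (0 : MvPolynomial (Fin 4 × Fin 4) K) else X i with hκ
    have hκX : ∀ v : Fin 4 × Fin 4, κ (X v) =
        if v ∈ ({((2 : Fin 4), (1 : Fin 4)), (2, 3)} : Finset (Fin 4 × Fin 4)) then 0 else X v :=
      fun v => by rw [hκ, aeval_X]
    have hk := congrArg κ h1
    simp only [map_add, map_mul, map_zero, hκX, hy1, hy2, hy3, hz1, hz2, hz3, Finset.mem_insert,
      Finset.mem_singleton, Prod.mk.injEq, Fin.reduceEq, and_true, and_false, or_false, or_true,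
      if_true, if_false, zero_mul, mul_zero, add_zero, zero_add] at hk
    have hprod : X (1, 1) * X (1, 3) * X (2, 2) * κ (u₁ + u₃) = 0 := by
      rw [map_add]; linear_combination hk
    exact (mul_eq_zero.1 hprod).resolve_left (X3ne _ _ _)
  -- Step 3: eliminate u₂, u₃, v₂, v₃: identity (2)
  have h2id : -(2 : MvPolynomial (Fin 4 × Fin 4) K) * y2 * y3 * z1 * u₁ - 2 * y1 * z2 * z3 * v₁ +
      (C a * y2 * z1 + (C b + C β) * y2 * z2 + C α * y1 * z2) * (y1 * z3 + y3 * z1) +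
      (C a' * y3 * z1 + (C c' + C γ') * y3 * z3 + C α' * y1 * z3) * (y1 * z2 + y2 * z1) = 0 := by
    have eu₂ : u₂ = -u₁ + C a * z1 + C b * z2 := by linear_combination hab
    have eu₃ : u₃ = -u₁ + C a' * z1 + C c' * z3 := by linear_combination hac
    have ev₂ : v₂ = -v₁ + C α * y1 + C β * y2 := by linear_combination hαβ
    have ev₃ : v₃ = -v₁ + C α' * y1 + C γ' * y3 := by linear_combination hαγ
    rw [eu₂, eu₃, ev₂, ev₃] at h1
    linear_combination h1
  -- linear pieces used below are homogeneous of degree 1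
  have hlin : ∀ (c₁ c₂ c₃ c₄ c₅ c₆ : K) (w₁ w₂ w₃ : MvPolynomial (Fin 4 × Fin 4) K),
      w₁.IsHomogeneous 1 → w₂.IsHomogeneous 1 → w₃.IsHomogeneous 1 →
      ((C c₁ + C c₂) * w₁ + (C c₃ + C c₄) * w₂ + (C c₅ + C c₆) * w₃).IsHomogeneous 1 := by
    intro c₁ c₂ c₃ c₄ c₅ c₆ w₁ w₂ w₃ h₁ h₂ h₃
    rw [← map_add, ← map_add, ← map_add]
    exact ((h₁.C_mul _).add (h₂.C_mul _)).add (h₃.C_mul _)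
  -- Step 4: kill y1 in (2) ⇒ 2 u₁ = δ y1 + W₁ ; kill z1 ⇒ 2 v₁ = ε z1 + W₂
  obtain ⟨δ, hδ⟩ : ∃ δ : K, 2 * u₁ - ((C a + C a') * z1 + (C b + C β) * z2 + (C c' + C γ') * z3) =
      C δ * y1 := by
    refine exists_single_of_kill_eq_zero (1, 1) ?_ ?_
    · rw [← hC2]
      exact (hu₁.C_mul 2).sub (hlin _ _ _ _ _ _ _ _ _ (isHomogeneous_X K _) (isHomogeneous_X K _)
        (isHomogeneous_X K _))
    · set κ : MvPolynomial (Fin 4 × Fin 4) K →ₐ[K] MvPolynomial (Fin 4 × Fin 4) K :=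
        aeval fun i => if i ∈ ({((1 : Fin 4), (1 : Fin 4))} : Finset (Fin 4 × Fin 4)) then
          (0 : MvPolynomial (Fin 4 × Fin 4) K) else X i with hκ
      have hκX : ∀ v : Fin 4 × Fin 4, κ (X v) =
          if v ∈ ({((1 : Fin 4), (1 : Fin 4))} : Finset (Fin 4 × Fin 4)) then 0 else X v :=
        fun v => by rw [hκ, aeval_X]
      have hκC : ∀ r : K, κ (C r) = C r := fun r => by rw [hκ, aeval_C, algebraMap_eq]
      have hk := congrArg κ h2id
      simp only [map_add, map_sub, map_mul, map_neg, map_ofNat, map_zero, hκX, hκC, hy1, hy2, hy3,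
        hz1, hz2, hz3, Finset.mem_singleton, Prod.mk.injEq, Fin.reduceEq, and_true, and_false,
        if_true, if_false, zero_mul, mul_zero, add_zero, zero_add] at hk
      have hprod : X (1, 2) * X (1, 3) * X (2, 1) *
          κ (2 * u₁ - ((C a + C a') * z1 + (C b + C β) * z2 + (C c' + C γ') * z3)) = 0 := by
        simp only [map_add, map_sub, map_mul, map_ofNat, hκX, hκC, hz1, hz2, hz3,
          Finset.mem_singleton, Prod.mk.injEq, Fin.reduceEq, and_false, false_and, if_false]
        linear_combination (-1 : MvPolynomial (Fin 4 × Fin 4) K) * hk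
      exact (mul_eq_zero.1 hprod).resolve_left (X3ne _ _ _)
  obtain ⟨ε, hε⟩ : ∃ ε : K, 2 * v₁ - ((C α + C α') * y1 + (C b + C β) * y2 + (C c' + C γ') * y3) =
      C ε * z1 := by
    refine exists_single_of_kill_eq_zero (2, 1) ?_ ?_
    · rw [← hC2]
      exact (hv₁.C_mul 2).sub (hlin _ _ _ _ _ _ _ _ _ (isHomogeneous_X K _) (isHomogeneous_X K _)
        (isHomogeneous_X K _))
    · set κ : MvPolynomial (Fin 4 × Fin 4) K →ₐ[K] MvPolynomial (Fin 4 × Fin 4) K :=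
        aeval fun i => if i ∈ ({((2 : Fin 4), (1 : Fin 4))} : Finset (Fin 4 × Fin 4)) then
          (0 : MvPolynomial (Fin 4 × Fin 4) K) else X i with hκ
      have hκX : ∀ v : Fin 4 × Fin 4, κ (X v) =
          if v ∈ ({((2 : Fin 4), (1 : Fin 4))} : Finset (Fin 4 × Fin 4)) then 0 else X v :=
        fun v => by rw [hκ, aeval_X]
      have hκC : ∀ r : K, κ (C r) = C r := fun r => by rw [hκ, aeval_C, algebraMap_eq]
      have hk := congrArg κ h2id
      simp only [map_add, map_sub, map_mul, map_neg, map_ofNat, map_zero, hκX, hκC, hy1, hy2, hy3,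
        hz1, hz2, hz3, Finset.mem_singleton, Prod.mk.injEq, Fin.reduceEq, and_true, and_false,
        if_true, if_false, zero_mul, mul_zero, add_zero, zero_add] at hk
      have hprod : X (1, 1) * X (2, 2) * X (2, 3) *
          κ (2 * v₁ - ((C α + C α') * y1 + (C b + C β) * y2 + (C c' + C γ') * y3)) = 0 := by
        simp only [map_add, map_sub, map_mul, map_ofNat, hκX, hκC, hy1, hy2, hy3,
          Finset.mem_singleton, Prod.mk.injEq, Fin.reduceEq, and_false, false_and, if_false]
        linear_combination (-1 : MvPolynomial (Fin 4 × Fin 4) K) * hk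
      exact (mul_eq_zero.1 hprod).resolve_left (X3ne _ _ _)
  -- Step 5: the remaining scalar relations, by evaluation at four 0/1 points
  have h2id' : -(y2 * y3 * z1) * (C δ * y1 + ((C a + C a') * z1 + (C b + C β) * z2 + (C c' + C γ') * z3))
      - y1 * z2 * z3 * (C ε * z1 + ((C α + C α') * y1 + (C b + C β) * y2 + (C c' + C γ') * y3)) +
      (C a * y2 * z1 + (C b + C β) * y2 * z2 + C α * y1 * z2) * (y1 * z3 + y3 * z1) +
      (C a' * y3 * z1 + (C c' + C γ') * y3 * z3 + C α' * y1 * z3) * (y1 * z2 + y2 * z1) = 0 := by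
    linear_combination h2id + y2 * y3 * z1 * hδ + y1 * z2 * z3 * hε
  have ev : ∀ S : Finset (Fin 4 × Fin 4), eval (fun w => if w ∈ S then (1 : K) else 0)
      (-(y2 * y3 * z1) * (C δ * y1 + ((C a + C a') * z1 + (C b + C β) * z2 + (C c' + C γ') * z3))
      - y1 * z2 * z3 * (C ε * z1 + ((C α + C α') * y1 + (C b + C β) * y2 + (C c' + C γ') * y3)) +
      (C a * y2 * z1 + (C b + C β) * y2 * z2 + C α * y1 * z2) * (y1 * z3 + y3 * z1) +
      (C a' * y3 * z1 + (C c' + C γ') * y3 * z3 + C α' * y1 * z3) * (y1 * z2 + y2 * z1)) = 0 := by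
    intro S; rw [h2id', map_zero]
  have q1 := ev {(1, 1), (1, 2), (1, 3), (2, 1)}
  have q2 := ev {(1, 1), (2, 1), (2, 2), (2, 3)}
  have q3 := ev {(1, 1), (1, 2), (2, 1), (2, 3)}
  have q4 := ev {(1, 1), (1, 3), (2, 1), (2, 2)}
  simp only [map_add, map_sub, map_mul, map_neg, eval_X, eval_C, hy1, hy2, hy3, hz1, hz2, hz3,
    Finset.mem_insert, Finset.mem_singleton, Prod.mk.injEq, Fin.reduceEq, and_true, and_false,
    or_false, or_true, if_true, if_false, mul_one, mul_zero, zero_mul, add_zero, zero_add,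
    sub_zero] at q1 q2 q3 q4
  have hδ0 : δ = 0 := by
    have : (2 : K) * δ = 0 := by linear_combination (-2 : K) * q1
    exact (mul_eq_zero.1 this).resolve_left h2
  have hε0 : ε = 0 := by
    have : (2 : K) * ε = 0 := by linear_combination (-2 : K) * q2
    exact (mul_eq_zero.1 this).resolve_left h2
  have haα : (C a : MvPolynomial (Fin 4 × Fin 4) K) = -C α' := by
    rw [← map_neg]; congr 1; linear_combination q3
  have haα' : (C a' : MvPolynomial (Fin 4 × Fin 4) K) = -C α := by
    rw [← map_neg]; congr 1; linear_combination q4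
  -- Step 6: conclude
  have e2u : 2 * u₁ = (C a + C a') * z1 + (C b + C β) * z2 + (C c' + C γ') * z3 := by
    rw [hδ0, map_zero, zero_mul, sub_eq_zero] at hδ; exact hδ
  have e2v : 2 * v₁ = (C α + C α') * y1 + (C b + C β) * y2 + (C c' + C γ') * y3 := by
    rw [hε0, map_zero, zero_mul, sub_eq_zero] at hε; exact hε
  have h22 : (2 : MvPolynomial (Fin 4 × Fin 4) K) * C (2⁻¹ : K) = 1 := by
    rw [← hC2, ← map_mul, mul_inv_cancel₀ h2, map_one]
  have hcn₁ : 2 * n₁ = (C c' + C γ') * (y1 * z3 + y3 * z1) + (C b + C β) * (y1 * z2 + y2 * z1) := by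
    rw [e₁]
    linear_combination y1 * e2u + z1 * e2v + y1 * z1 * haα + y1 * z1 * haα'
  have hcn₂ : 2 * n₂ = -((C c' + C γ') * (y2 * z3 + y3 * z2)) + (C α - C α') * (y1 * z2 + y2 * z1) := by
    have eu₂ : u₂ = -u₁ + C a * z1 + C b * z2 := by linear_combination hab
    have ev₂ : v₂ = -v₁ + C α * y1 + C β * y2 := by linear_combination hαβ
    rw [e₂, eu₂, ev₂]
    linear_combination (-1 : MvPolynomial (Fin 4 × Fin 4) K) * y2 * e2u - z2 * e2v +
      y2 * z1 * haα - y2 * z1 * haα'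
  have hcn₃ : 2 * n₃ = -((C b + C β) * (y2 * z3 + y3 * z2)) - (C α - C α') * (y1 * z3 + y3 * z1) := by
    have eu₃ : u₃ = -u₁ + C a' * z1 + C c' * z3 := by linear_combination hac
    have ev₃ : v₃ = -v₁ + C α' * y1 + C γ' * y3 := by linear_combination hαγ
    rw [e₃, eu₃, ev₃]
    linear_combination (-1 : MvPolynomial (Fin 4 × Fin 4) K) * y3 * e2u - z3 * e2v -
      y3 * z1 * haα + y3 * z1 * haα'
  refine ⟨(c' + γ') * 2⁻¹, (b + β) * 2⁻¹, (α - α') * 2⁻¹, ?_, ?_, ?_⟩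
  · rw [map_mul, map_mul, map_add, map_add]
    linear_combination C (2⁻¹ : K) * hcn₁ - n₁ * h22
  · rw [map_mul, map_mul, map_add, map_sub]
    linear_combination C (2⁻¹ : K) * hcn₂ - n₂ * h22
  · rw [map_mul, map_mul, map_add, map_sub]
    linear_combination C (2⁻¹ : K) * hcn₃ - n₃ * h22

/-- **Cross products orthogonal to `q'` vanish**: if `ℓ, m` are triples of linear forms whose
cross product `n = ℓ × m` satisfies `n · (p23, p13, p12) = 0`, then `ℓ × m = 0` (all three
`2 × 2` minors of `[ℓ | m]` vanish).  Proof: `n` is a Koszul combination (`quadSyzygy_koszul`);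
`ℓ · n = 0 = m · n` are then linear syzygies, so (`linSyzygy_eq_zero`) `ℓ` and `m` are both
proportional to one constant vector, whence `ℓ × m = 0`. [folklore] -/
theorem minors_eq_zero_of_cross_dot_eq_zero (h2 : (2 : K) ≠ 0)
    (l₀ l₁ l₂ m₀ m₁ m₂ : MvPolynomial (Fin 4 × Fin 4) K)
    (hl₀ : l₀.IsHomogeneous 1) (hl₁ : l₁.IsHomogeneous 1) (hl₂ : l₂.IsHomogeneous 1)
    (hm₀ : m₀.IsHomogeneous 1) (hm₁ : m₁.IsHomogeneous 1) (hm₂ : m₂.IsHomogeneous 1)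
    (h : (l₁ * m₂ - l₂ * m₁) * (X (1, 2) * X (2, 3) + X (1, 3) * X (2, 2)) +
         (l₂ * m₀ - l₀ * m₂) * (X (1, 1) * X (2, 3) + X (1, 3) * X (2, 1)) +
         (l₀ * m₁ - l₁ * m₀) * (X (1, 1) * X (2, 2) + X (1, 2) * X (2, 1)) = 0) :
    l₁ * m₂ - l₂ * m₁ = 0 ∧ l₂ * m₀ - l₀ * m₂ = 0 ∧ l₀ * m₁ - l₁ * m₀ = 0 := by
  obtain ⟨lam, mu, nu, e₀, e₁, e₂⟩ := quadSyzygy_koszul h2 _ _ _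
    ((hl₁.mul hm₂).sub (hl₂.mul hm₁)) ((hl₂.mul hm₀).sub (hl₀.mul hm₂))
    ((hl₀.mul hm₁).sub (hl₁.mul hm₀)) h
  -- `ℓ · (ℓ × m) = 0` and `m · (ℓ × m) = 0`, rewritten as linear syzygies
  have hl : l₀ * (l₁ * m₂ - l₂ * m₁) + l₁ * (l₂ * m₀ - l₀ * m₂) + l₂ * (l₀ * m₁ - l₁ * m₀) = 0 := by ring
  have hm : m₀ * (l₁ * m₂ - l₂ * m₁) + m₁ * (l₂ * m₀ - l₀ * m₂) + m₂ * (l₀ * m₁ - l₁ * m₀) = 0 := by ring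
  rw [e₀, e₁, e₂] at hl hm
  obtain ⟨hl1, hl2, hl3⟩ := linSyzygy_eq_zero h2 (-(C lam * l₁) - C mu * l₂) (C lam * l₀ - C nu * l₂)
    (C mu * l₀ + C nu * l₁) ((hl₁.C_mul _).neg.sub (hl₂.C_mul _))
    ((hl₀.C_mul _).sub (hl₂.C_mul _)) ((hl₀.C_mul _).add (hl₁.C_mul _))
    (by linear_combination hl)
  obtain ⟨hm1, hm2, hm3⟩ := linSyzygy_eq_zero h2 (-(C lam * m₁) - C mu * m₂) (C lam * m₀ - C nu * m₂)
    (C mu * m₀ + C nu * m₁) ((hm₁.C_mul _).neg.sub (hm₂.C_mul _))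
    ((hm₀.C_mul _).sub (hm₂.C_mul _)) ((hm₀.C_mul _).add (hm₁.C_mul _))
    (by linear_combination hm)
  have key : ∀ s : K, s ≠ 0 → C s * C s * (l₁ * m₂ - l₂ * m₁) = 0 →
      C s * C s * (l₂ * m₀ - l₀ * m₂) = 0 → C s * C s * (l₀ * m₁ - l₁ * m₀) = 0 →
      l₁ * m₂ - l₂ * m₁ = 0 ∧ l₂ * m₀ - l₀ * m₂ = 0 ∧ l₀ * m₁ - l₁ * m₀ = 0 := by
    intro s hs h0 h1 h2
    have hCs : (C s : MvPolynomial (Fin 4 × Fin 4) K) * C s ≠ 0 :=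
      mul_ne_zero (C_ne_zero.2 hs) (C_ne_zero.2 hs)
    exact ⟨(mul_eq_zero.1 h0).resolve_left hCs, (mul_eq_zero.1 h1).resolve_left hCs,
      (mul_eq_zero.1 h2).resolve_left hCs⟩
  by_cases hlam : lam ≠ 0
  · exact key lam hlam (by linear_combination (-(C lam * m₂)) * hl1 + (C lam * l₂) * hm1)
      (by linear_combination (-(C lam * m₂)) * hl2 + (C lam * l₂) * hm2)
      (by linear_combination (C nu * m₂) * hl1 - (C mu * m₂) * hl2 - (C lam * l₀) * hm1 -
        (C lam * l₁) * hm2)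
  by_cases hmu : mu ≠ 0
  · exact key mu hmu (by linear_combination (C mu * m₁) * hl1 - (C mu * l₁) * hm1)
      (by linear_combination (-(C mu * m₀)) * hl1 - (C mu * m₂) * hl3 - (C mu * l₁) * hm2)
      (by linear_combination (C mu * m₁) * hl3 - (C mu * l₁) * hm3)
  by_cases hnu : nu ≠ 0
  · exact key nu hnu
      (by linear_combination (C nu * m₁) * hl2 + (C nu * m₂) * hl3 + (C nu * l₀) * hm1)
      (by linear_combination (-(C nu * m₀)) * hl2 + (C nu * l₀) * hm2)
      (by linear_combination (-(C nu * m₀)) * hl3 + (C nu * l₀) * hm3)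
  push Not at hlam hmu hnu
  refine ⟨?_, ?_, ?_⟩
  · rw [e₀, hlam, hmu, map_zero]; ring
  · rw [e₁, hlam, hnu, map_zero]; ring
  · rw [e₂, hmu, hnu, map_zero]; ring

end Summit.ValiantsHypothesis.LiftNullstellensatz

end
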